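import Literature.InformationTheory.QuantumCodes.KnillLaflammeForms
import Literature.Computability.AlgebraicComplexity.SubspaceProjection
import HarnessLib

/-!
# The Knill–Laflamme theorem for a code given as a SUBSPACE

Venture QEC (cell `qec`, PARTITION row 03; known mathematics). `KnillLaflammeForms.lean` states
the quantum error-correction conditions in codeword form on a `Submodule` `C ≤ ℂ^n`
(`KnillLaflammeSubspaceCondition C E`: `⟨ψ|E_a†E_b|φ⟩ = α_ab ⟨ψ|φ⟩` on `C`) and proves them
equivalent to the projector form for any orthogonal projector `P` with `C = {v | Pv = v}`. This
file supplies that projector for EVERY subspace (Gram–Schmidt, through the tree's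
`Literature.Computability.AlgebraicComplexity.exists_orthonormalFrame`) and closes the loop with
Theorem 10.1:

* `exists_proj_onto` — every `C ≤ ℂ^n` has an orthogonal projector `P` (`P† = P = P²`,
  `C = {v | Pv = v}`) — "let `P` be the projector onto `C`";
* **`knillLaflammeSubspaceCondition_iff_exists_isCorrectable`** — `C` satisfies the codeword
  conditions iff some (equivalently: every, `isCorrectable_of_knillLaflammeSubspaceCondition`)
  orthogonal projector onto `C` admits a correcting recovery (`IsCorrectable`, NC Thm 10.1).

## References
* M. A. Nielsen, I. L. Chuang, *Quantum Computation and Quantum Information*, CUP 2010, §10.3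
  Theorem 10.1 ("Let `C` be a quantum code, and let `P` be the projector onto `C`"), p. 436.
-/

noncomputable section

namespace Literature.InformationTheory.QuantumCodes

open Matrix Literature.Computability.QuantumComplexity
open scoped ComplexOrder

variable {n : Type*} [Fintype n] [DecidableEq n]
variable {ι : Type*} [Fintype ι]

omit [DecidableEq n] in
/-- **Every subspace has an orthogonal projector** ("let `P` be the projector onto `C`"): for
`C ≤ ℂ^n` there is `P` with `P† = P`, `P² = P` and `C = {v | P v = v}` (namely `P = B B†` for an
orthonormal frame `B` of `C`). [cite: NielsenChuang2010, §10.3 Thm 10.1 ("let P be the projector onto C"), p. 436] -/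
theorem exists_proj_onto (C : Submodule ℂ (n → ℂ)) :
    ∃ P : Matrix n n ℂ, P.IsHermitian ∧ P * P = P ∧ ∀ v, v ∈ C ↔ P *ᵥ v = v := by
  obtain ⟨k, B, -, hBB, hcol, hfix⟩ :=
    Literature.Computability.AlgebraicComplexity.exists_orthonormalFrame C
  refine ⟨B * Bᴴ, Matrix.isHermitian_mul_conjTranspose_self B,
    Literature.Computability.AlgebraicComplexity.frame_proj_mul_self hBB, fun v => ⟨hfix v, fun hv => ?_⟩⟩
  rw [← hv]
  exact Literature.Computability.AlgebraicComplexity.frame_proj_mulVec_mem hcol v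

/-- For ANY orthogonal projector `P` onto `C`: the codeword conditions on `C` give a correcting
recovery for `P` (Theorem 10.1, sufficiency, subspace form). [cite: NielsenChuang2010, §10.3 Thm 10.1, p. 436] -/
theorem isCorrectable_of_knillLaflammeSubspaceCondition {C : Submodule ℂ (n → ℂ)}
    {E : ι → Matrix n n ℂ} (h : KnillLaflammeSubspaceCondition C E) {P : Matrix n n ℂ}
    (hP : P.IsHermitian) (hPP : P * P = P) (hC : ∀ v, v ∈ C ↔ P *ᵥ v = v) : IsCorrectable P E :=
  (isCorrectable_iff_knillLaflammeCondition hP hPP E).mpr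
    ((knillLaflammeCondition_iff_subspace hP hPP C hC E).mpr h)

/-- Conversely a correcting recovery for some orthogonal projector onto `C` gives the codeword
conditions (Theorem 10.1, necessity, subspace form). [cite: NielsenChuang2010, §10.3 Thm 10.1, p. 436] -/
theorem knillLaflammeSubspaceCondition_of_isCorrectable {C : Submodule ℂ (n → ℂ)}
    {E : ι → Matrix n n ℂ} {P : Matrix n n ℂ} (hP : P.IsHermitian) (hPP : P * P = P)
    (hC : ∀ v, v ∈ C ↔ P *ᵥ v = v) (h : IsCorrectable P E) : KnillLaflammeSubspaceCondition C E :=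
  (knillLaflammeCondition_iff_subspace hP hPP C hC E).mp
    ((isCorrectable_iff_knillLaflammeCondition hP hPP E).mp h)

/-- **Theorem 10.1 for a subspace code.** A code `C ≤ ℂ^n` satisfies the quantum error-correction
conditions in codeword form, `⟨ψ|E_a†E_b|φ⟩ = α_ab ⟨ψ|φ⟩` (`α` Hermitian) for all `ψ, φ ∈ C`, iff
there exist an orthogonal projector `P` onto `C` and a trace-preserving recovery `ℛ` with
`ℛ(ℰ(PρP)) ∝ PρP` (`IsCorrectable P E`). (proved)
[cite: NielsenChuang2010, §10.3 Thm 10.1, p. 436] [cite: KnillLaflamme1997, Thm 3.2] -/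
theorem knillLaflammeSubspaceCondition_iff_exists_isCorrectable (C : Submodule ℂ (n → ℂ))
    (E : ι → Matrix n n ℂ) :
    KnillLaflammeSubspaceCondition C E ↔
      ∃ P : Matrix n n ℂ, P.IsHermitian ∧ P * P = P ∧ (∀ v, v ∈ C ↔ P *ᵥ v = v) ∧ IsCorrectable P E := by
  constructor
  · intro h
    obtain ⟨P, hP, hPP, hC⟩ := exists_proj_onto C
    exact ⟨P, hP, hPP, hC, isCorrectable_of_knillLaflammeSubspaceCondition h hP hPP hC⟩
  · rintro ⟨P, hP, hPP, hC, h⟩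
    exact knillLaflammeSubspaceCondition_of_isCorrectable hP hPP hC h

end Literature.InformationTheory.QuantumCodes
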